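/- LEAD seat `ym-line-cbag-p1` (prover-ym-line-cbag-p1-g24-0), route `EguchiKawaiDirectionLadder` (ideator ym-idea-2, LINE 8),
crux K_A `TripleSmallBallMargin` (stmt-QuantumFields-27724), S8 (final form): the RANK-ROBUST PAIR SMALL-BALL BOUND Ψ_rob on
`U(n) × U(n)` in the exact shape consumed by the `h_Ψ` slot of width seat w4's decoupling capstone — width seat w3's rank-robust
pair reduction `RankRobust.ekHaar_two_rankRobust_le_ekAction` (S7/S8-reduction, covering argument) composed with the LEAD's
`pairSmallBall_holds` (S4).  ROUTE-INDEPENDENT up to the (a′)-corollary module it imports.  Nothing here bears on the Yang–Mills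
mass gap (barrier-ledger line onto `EguchiKawaiBreakdown`). -/
import Summits.QuantumFields.YangMills.Theorems.EguchiKawaiDirectionLadderFreeTripleSmallBallLe1
import Summits.QuantumFields.YangMills.Theorems.EguchiKawaiDirectionLadderRankRobustPair
import HarnessLib

/-!
# Route `EguchiKawaiDirectionLadder`, crux `TripleSmallBallMargin`: Ψ_rob — the rank-robust pair small-ball bound (S8, final form)

`haarPair_rankRobustComm_le`: for every `η > 0` there are `C ≥ 0` and `N₀` such that for all `n ≥ N₀`, `k ≤ n`, `0 < t ≤ 1/18`:
`Haar²{(P₁,P₂) ∈ U(n)² : ∃ L, rank L ≤ k, Σ_{ij} |(P₁P₂ − P₂P₁ − L)_{ij}|² ≤ n t}`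
`  ≤ 33^{n²} (100/t²)^{kn} · exp(n²(C − η log(18 t))) · (18 t)^{C(n,2)}`.
PROOF: the pair event is the `finTwoArrow`-image of w3's two-link robust event; `RankRobust.ekHaar_two_rankRobust_le_ekAction` bounds it
by `33^{n²}(100/t²)^{kn} · ekHaar 2 n {S_R ≤ 18t}`, and `pairSmallBall_holds` bounds the last factor.
-/

set_option autoImplicit false

noncomputable section

open MeasureTheory
open scoped ENNReal
open Literature.Barriers.QuantumFields

namespace Summit.QuantumFields.YangMills.Theorems.EguchiKawaiDirectionLadder

open Literature.MathematicalPhysics.QuantumFieldTheory (haarProbability)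

variable {n : ℕ}

/-- The pair form of the rank-robust commutator event is the `finTwoArrow`-pullback of the two-link form. -/
theorem rankRobustPairSet_eq_preimage (k : ℕ) (a : ℝ) :
    {P : UN n × UN n | ∃ L : Matrix (Fin n) (Fin n) ℂ, L.rank ≤ k ∧
        ∑ i, ∑ j, ‖((P.1 : Matrix (Fin n) (Fin n) ℂ) * (P.2 : Matrix (Fin n) (Fin n) ℂ) -
          (P.2 : Matrix (Fin n) (Fin n) ℂ) * (P.1 : Matrix (Fin n) (Fin n) ℂ) - L) i j‖ ^ 2 ≤ a} =
      MeasurableEquiv.finTwoArrow.symm ⁻¹'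
        {U : EKConfig 2 n | ∃ L : Matrix (Fin n) (Fin n) ℂ, L.rank ≤ k ∧ frobSq (ekComm U 0 1 - L) ≤ a} := by
  ext P
  simp only [Set.mem_setOf_eq, Set.mem_preimage, MeasurableEquiv.finTwoArrow_symm_apply, ekComm, frobSq,
    Fin.cons_zero, Fin.cons_one]

/-- **Ψ_rob: the rank-robust pair small-ball bound** on `U(n) × U(n)` (w3's reduction ∘ the pair small-ball bound). -/
theorem haarPair_rankRobustComm_le {η : ℝ} (hη : 0 < η) :
    ∃ C : ℝ, 0 ≤ C ∧ ∃ N₀ : ℕ, ∀ n : ℕ, N₀ ≤ n → ∀ k : ℕ, k ≤ n → ∀ t : ℝ, 0 < t → t ≤ 1 / 18 →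
      (haarProbability (UN n)).prod (haarProbability (UN n))
          {P : UN n × UN n | ∃ L : Matrix (Fin n) (Fin n) ℂ, L.rank ≤ k ∧
            ∑ i, ∑ j, ‖((P.1 : Matrix (Fin n) (Fin n) ℂ) * (P.2 : Matrix (Fin n) (Fin n) ℂ) -
              (P.2 : Matrix (Fin n) (Fin n) ℂ) * (P.1 : Matrix (Fin n) (Fin n) ℂ) - L) i j‖ ^ 2 ≤ n * t} ≤
        ENNReal.ofReal ((33 : ℝ) ^ (n * n) * (100 / t ^ 2) ^ (k * n)) *
          ENNReal.ofReal (Real.exp ((n : ℝ) ^ 2 * (C - η * Real.log (18 * t))) * (18 * t) ^ n.choose 2) := by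
  obtain ⟨C, hC, N₀, hΨ⟩ := pairSmallBall_holds η hη
  refine ⟨C, hC, max N₀ 1, fun n hn k hk t ht ht18 => ?_⟩
  have hN₀ : N₀ ≤ n := (le_max_left _ _).trans hn
  have hnpos : 0 < n := (le_max_right _ _).trans hn
  have ht1 : t ≤ 1 := ht18.trans (by norm_num)
  have h18 : 0 < 18 * t := by positivity
  have h18' : 18 * t ≤ 1 := by linarith
  set μ := haarProbability (UN n) with hμ
  have hmp : MeasurePreserving (MeasurableEquiv.finTwoArrow (α := UN n)) (ekHaar 2 n) (μ.prod μ) := by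
    unfold ekHaar; exact MeasureTheory.measurePreserving_finTwoArrow μ
  rw [rankRobustPairSet_eq_preimage, hmp.symm.measure_preimage_equiv]
  refine (RankRobust.ekHaar_two_rankRobust_le_ekAction hnpos hk ht ht1).trans ?_
  gcongr
  exact hΨ n hN₀ (18 * t) h18 h18'

end Summit.QuantumFields.YangMills.Theorems.EguchiKawaiDirectionLadder

end
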